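import Literature.MathematicalPhysics.QuantumFieldTheory.Balaban1983to89.B8Eq1101DentedCubeMemberParametrixIdentity

/-!
# `Balaban1983to89.B8Eq1101DentedCubeMemberCommutator` — [Balaban1984PropagatorsII] (2.52)–(2.55) ∕ [Balaban1985RegularSpaces] (1.101) ON THE DENTED CUBE MEMBER of
# [Balaban1985Variational] (148)–(150): THE COMMUTATOR `K₁` OF THE TWO-REGION PARAMETRIX IS SMALL IN THE `(−2)`-WEIGHTED SUP NORM, AND `P u` IS THE REGION-A FIELD AT DEEP
# BONDS — dented twins of dag-n05-c's F4b `B8Eq1101CubeMemberParametrixIdentity` §§4–5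

statement-level skeleton of published theorems with citation tags; proofs where landed; nothing here is a claim about the Yang–Mills mass gap

`[Balaban1984PropagatorsII]` ("B6", CMP **96** (1984) 223–250) (2.48) p. 231, (2.52)–(2.55) p. 232–233 («the norms of the operators … are small for M sufficiently large»), (2.67)
p. 234; `[Balaban1985RegularSpaces]` ("B8" = [6], CMP **99** (1985) 75–102) (1.101) p. 93, (1.91) p. 91, (1.131) p. 99; `[Balaban1985Variational]` ("[15]", CMP **102** (1985)
277–309) (148)–(151) p. 301.  PDF held: `paper:balaban1984-cmp96-propagators-rt-ii`, `paper:balaban1985-cmp99-regular-spaces-gauge-fixing`.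

CITATION HEADER (lean-in-tree rule).  Cell `pub-ymgap` (YM Track A, HUMAN RULING D-0062), DAG node N05 = [B8], seat `pub-ymgap-dag-n05-e` (g32; FAN-OUT §N05 row s3b,
Proposition-6 lane; piece (d2-f) of the (β) road — the dented parametrix, file 3: g31 HANDOFF «Next 1 (iii)», dag-n05-c STANDING GO I.42366, this seat INTENT I.43617).
WHY THIS FILE.  F4b §4 bounds the commutator remainder `K₁u` of the parametrix identity (file 2 of this unit) at a site `x ∈ □_j` with the weight `(Lʲη)²`: at tower level
`≥ 2` the whole row vanishes, at level `≤ 1` the cutoffs are `1∕s`-Lipschitz; F4b §5 reads the gradient of `P u` at deep bonds as p21's forward difference of the region-A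
field.  THIS FILE re-runs both on the DENTED member (`x ∈ Ω′_j = c.sq j`, cells `c.lamS`, box member `D.lev = levD`): the tower of `x` is g31's dented cover, the level-`≥ 2`
vanishing and the «`x ∈ Ω′_j` ⟹ `j ≤` level» step are `mem_cube_of_tower` (p673253) and g31's `not_mem_sq_of_tower_lt`; the deep-bond lemma only needs the box embedding of `□₁`.

WHAT THIS FILE PROVES (kernel-checked; data as in file 2).
* §4 ★★ `commutator_bound` — `(Lʲη)²·|(K₁u)(x)| ≤ 10(d+1)L²(A + B)∕s` for `x ∈ Ω′_j`, `j ≤ k` (`A ≥ η²|gAx|`, `B ≥ |gBx|`, `a₁ ≤ 8`).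
* §5 `parametrix_grad_deep` — `(Pu)(y + e_μ) − (Pu)(y) = η²·(∂_μ G′uA)(y + t)` at bonds of depth `≥ 4s`.
HONEST SCOPE ∕ NOT CLAIMED.  Elementary row sums and identities; no estimate of [4]∕[6] beyond them; count-neutral; N05 ∕ N07 NOT discharged; one finite `T⁴` programme at
fixed `ε`, Bałaban as printed; nothing continuum ∕ ℝ⁴ ∕ OS ∕ mass-gap ∕ Clay.  No `sorry`, no `def`, no `instance`, no `notation`.  Unit `pub-ymgap-dag-n05-e` (g32), 2026-08-28.

RELATED IN THE TREE, NOT DUPLICATED (`rg -l 'Eq1101DentedCubeMemberCommutator' Balaban1983to89` = 0, 2026-08-28T22:55Z): F4b `B8Eq1101CubeMemberParametrixIdentity` §§4–5 (dag-n05-c;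
the PURE model, `abs_row_le` ∕ `card_filter_block_le` USED), F4a `B8Eq1101CubeMemberCutoffs` (USED), `B8DentedCubeMemberBoxTowers` (g32), g31's dented geometry (USED).
-/
noncomputable section

namespace Literature.MathematicalPhysics.QuantumFieldTheory.Balaban1983to89.B8Eq1101DentedCubeMemberCommutator

open scoped Matrix
open B6MultiLevelBoxOperator (N0 mlOp gml levC)
open B4Reflection242 (boxDom mem_boxDom blk)
open B7Prop1Explicit (e)
open B8Eq131Cubes (l1dist cube cube_anti)
open B8Eq191FlatDirichletDepth (depth depth_ge_of_mem_inner mem_cube_iff_one_le_depth)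
open B8CubeMemberBoxDomains (shift boxP add_shift_sub_shift)
open B8CubeMemberBoxDomainsL0 (mem_boxDom_of_mem_cube_zero)
open B8CubeMemberTorusDomainsDented (levD levD_le)
open B8Eq191FlatLettersDentedCubeMember (towers_disjoint_dented)
open B8Eq192DentedCubeMemberOfReal1G (cover_dented not_mem_sq_of_tower_lt)
open B8DentedCubeMemberZd (lamST_top)
open B8DentedCubeMemberBoxTowers (mem_cube_of_tower towerBlock_subset_sq_zero)
open B8Eq1101CubeMemberCutoffs (cutA cutAt cutB cutBt cut_lipschitz cutAt_eq_of_depth cutBt_facts abs_depth_sub_step_le abs_depth_sub_le_l1dist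
  l1dist_le_of_blockMap_eq blockMap_pow_zero)
open B8Eq1101CubeMemberParametrixIdentity (abs_row_le card_filter_block_le)
open B8Eq191FlatDirichletWall (abs_l1dist_step_le l1dist_self)
open B6Prop22DerivMultiLevelBox (dMat dMat_mulVec_of_mem)
open B8CubeMemberBoxRows (add_shift_single)
open Node00 (CubeB8D)
open Literature.MathematicalPhysics.QuantumLattice (blockMap)

variable {d : ℕ}

/-! ## §4 The size of the commutator `K₁u` -/

open Classical in
/-- **THE COMMUTATOR IS SMALL IN THE `(−2)`-WEIGHTED SUP NORM.**  With `A ≥ η²|gAx|`, `B ≥ |gBx|` (`gBx = 0` off `□₀`), ramp length `s ≥ 1` and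
`4s ≤ ρL`: for every `x ∈ □_j` (`j ≤ n`),
`(Lʲη)²·|Σ_{z∈□₀} K(x,z)((h̃_A(z) − h̃_A(x))η²gAx(z) + (h̃_B(z) − h̃_B(x))gBx(z))| ≤ 10(d+1)L²(A + B)∕s`.
Mechanism: at a site of tower level `≥ 2` every entry of the row vanishes (the site, its neighbours and its tower block are deeper than `4s` into `□₁`, where
`h̃_A ≡ 1`, `h̃_B ≡ 0`); at a site of level `≤ 1` the row has `2(d+1)` neighbour entries `η⁻²` against differences `≤ 1∕s`, and at most `L^{d+1}` block
entries `η⁻²a₁L^{−2}L^{−(d+1)}` against differences `≤ (d+1)(L−1)∕s` (the cutoffs are `1∕s`-Lipschitz in `|·|₁`), and the weight is `≤ (Lη)²`.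
[cite: Balaban1984PropagatorsII, (2.52)–(2.55) p.232–233 («the norms of the operators … are small for M sufficiently large»), (2.48) p.231; Balaban1985RegularSpaces, (1.101) p.93] -/
theorem commutator_bound {ℓ K' : ℕ} {Ω : ℕ → Set (Fin (d + 1) → ℤ)} (c : CubeB8D (d + 1) (ℓ + 1) K' Ω)
    {η : ℝ} (hη : η ≠ 0) (w aw : ℕ → ℝ) (hw0 : ∀ j, 0 ≤ w j) (haw0 : 0 ≤ aw 1) (haw8 : aw 1 ≤ 8)
    (hw : ∀ j, j ≤ c.k → w j * (((((ℓ + 1 : ℕ) : ℝ) ^ (d + 1))⁻¹) ^ j) ^ 2 = (η ^ 2)⁻¹ * levC d ℓ aw j)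
    (K : (Fin (d + 1) → ℤ) → (Fin (d + 1) → ℤ) → ℝ)
    (hK : ∀ x z, K x z = ((η ^ 2)⁻¹ * ∑ μ : Fin (d + 1), ((2 : ℝ) * (if z = x then (1 : ℝ) else 0) - (if z = x + e μ then (1 : ℝ) else 0)
        - (if z = x - e μ then (1 : ℝ) else 0))) +
        (∑ j ∈ Finset.range (c.k + 1), (if blockMap ((ℓ + 1) ^ j) x ∈ c.lamS j ∧
            blockMap ((ℓ + 1) ^ j) z = blockMap ((ℓ + 1) ^ j) x then
          w j * (((((ℓ + 1 : ℕ) : ℝ) ^ (d + 1))⁻¹) ^ j) ^ 2 else 0)))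
    (S : Finset (Fin (d + 1) → ℤ)) (hS : ∀ z, z ∈ S ↔ z ∈ c.sq 0)
    {s : ℕ} (hs : 1 ≤ s) (hρs : 4 * (s : ℤ) ≤ c.ρ * (ℓ + 1 : ℕ))
    (gAx gBx : (Fin (d + 1) → ℤ) → ℝ) {A B : ℝ} (hA0 : 0 ≤ A) (hB0 : 0 ≤ B) (hA : ∀ z, η ^ 2 * |gAx z| ≤ A) (hB : ∀ z, |gBx z| ≤ B)
    (hgBx0 : ∀ z, z ∉ S → gBx z = 0)
    {x : Fin (d + 1) → ℤ} (hx : x ∈ S) {j : ℕ} (hj : j ≤ c.k) (hxj : x ∈ c.sq j) :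
    ((((ℓ + 1 : ℕ) : ℝ)) ^ j * η) ^ 2 *
      |∑ z ∈ S, K x z * ((cutAt (Nat.succ_pos d) (ℓ + 1) c.a c.M c.ρ c.k s z - cutAt (Nat.succ_pos d) (ℓ + 1) c.a c.M c.ρ c.k s x) * (η ^ 2 * gAx z)
        + (cutBt (Nat.succ_pos d) (ℓ + 1) c.a c.M c.ρ c.k s z - cutBt (Nat.succ_pos d) (ℓ + 1) c.a c.M c.ρ c.k s x) * gBx z)|
      ≤ 10 * ((d : ℝ) + 1) * (((ℓ + 1 : ℕ) : ℝ)) ^ 2 * (A + B) / s := by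
  have hd : 0 < d + 1 := Nat.succ_pos d
  have hL : 1 ≤ ℓ + 1 := Nat.succ_pos ℓ
  have hk : 1 ≤ c.k := c.one_le_k
  have hρL : ℓ + 1 ≤ c.ρ := c.L_le_ρ
  have hLr : (1 : ℝ) ≤ ((ℓ + 1 : ℕ) : ℝ) := by exact_mod_cast hL
  have hs0 : (0 : ℝ) < s := by exact_mod_cast hs
  have hx0 : x ∈ cube (ℓ + 1) c.a c.M c.ρ c.k 0 := by rw [← c.sq_zero]; exact (hS x).mp hx
  have hxF : x ∈ c.sq 0 := (hS x).mp hx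
  -- the commutator integrand and its pointwise bound
  set cc : (Fin (d + 1) → ℤ) → ℝ := fun z => (cutAt hd (ℓ + 1) c.a c.M c.ρ c.k s z - cutAt hd (ℓ + 1) c.a c.M c.ρ c.k s x) * (η ^ 2 * gAx z)
      + (cutBt hd (ℓ + 1) c.a c.M c.ρ c.k s z - cutBt hd (ℓ + 1) c.a c.M c.ρ c.k s x) * gBx z with hcc
  have hcx : cc x = 0 := by simp only [hcc, sub_self, zero_mul, add_zero]
  have hcle : ∀ z, |cc z| ≤ (l1dist z x : ℝ) / s * (A + B) := by
    intro z
    obtain ⟨-, hlipA, hlipB⟩ := cut_lipschitz hd (ℓ + 1) c.a c.M c.ρ c.k hs z x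
    have hl0 : (0 : ℝ) ≤ (l1dist z x : ℝ) / s := div_nonneg (by exact_mod_cast B8Eq191FlatDirichletWall.l1dist_nonneg z x) hs0.le
    have h1 : |(cutAt hd (ℓ + 1) c.a c.M c.ρ c.k s z - cutAt hd (ℓ + 1) c.a c.M c.ρ c.k s x) * (η ^ 2 * gAx z)| ≤ (l1dist z x : ℝ) / s * A := by
      rw [abs_mul, abs_mul, abs_of_nonneg (sq_nonneg η)]
      exact mul_le_mul hlipA (hA z) (by positivity) hl0
    have h2 : |(cutBt hd (ℓ + 1) c.a c.M c.ρ c.k s z - cutBt hd (ℓ + 1) c.a c.M c.ρ c.k s x) * gBx z| ≤ (l1dist z x : ℝ) / s * B := by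
      by_cases hzS : z ∈ S
      · have hz0 : z ∈ cube (ℓ + 1) c.a c.M c.ρ c.k 0 := by rw [← c.sq_zero]; exact (hS z).mp hzS
        rw [abs_mul]
        exact mul_le_mul (hlipB hz0 hx0).2 (hB z) (abs_nonneg _) hl0
      · rw [hgBx0 z hzS, mul_zero, abs_zero]; positivity
    calc |cc z| ≤ |(cutAt hd (ℓ + 1) c.a c.M c.ρ c.k s z - cutAt hd (ℓ + 1) c.a c.M c.ρ c.k s x) * (η ^ 2 * gAx z)|
          + |(cutBt hd (ℓ + 1) c.a c.M c.ρ c.k s z - cutBt hd (ℓ + 1) c.a c.M c.ρ c.k s x) * gBx z| := abs_add_le _ _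
      _ ≤ (l1dist z x : ℝ) / s * A + (l1dist z x : ℝ) / s * B := add_le_add h1 h2
      _ = (l1dist z x : ℝ) / s * (A + B) := by ring
  -- deep sites: the integrand vanishes at sites of depth `≥ ρL`
  have hdeep : ∀ z, (c.ρ : ℤ) * (ℓ + 1 : ℕ) ≤ depth hd (ℓ + 1) c.a c.M c.ρ c.k 1 z → (c.ρ : ℤ) * (ℓ + 1 : ℕ) ≤ depth hd (ℓ + 1) c.a c.M c.ρ c.k 1 x → cc z = 0 := by
    intro z hz hxd
    have h1 : cutAt hd (ℓ + 1) c.a c.M c.ρ c.k s z = 1 := (cutAt_eq_of_depth hd (ℓ + 1) c.a c.M c.ρ c.k hs z).1 (by linarith)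
    have h2 : cutAt hd (ℓ + 1) c.a c.M c.ρ c.k s x = 1 := (cutAt_eq_of_depth hd (ℓ + 1) c.a c.M c.ρ c.k hs x).1 (by linarith)
    have h3 : cutBt hd (ℓ + 1) c.a c.M c.ρ c.k s z = 0 := (cutBt_facts hd (ℓ + 1) c.a c.M c.ρ c.k hs z).2.2.1 (by linarith)
    have h4 : cutBt hd (ℓ + 1) c.a c.M c.ρ c.k s x = 0 := (cutBt_facts hd (ℓ + 1) c.a c.M c.ρ c.k hs x).2.2.1 (by linarith)
    simp only [hcc, h1, h2, h3, h4, sub_self, zero_mul, add_zero]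
  -- the row bound of §4
  have hrow := abs_row_le (ℓ + 1) c.k c.lamS w hw0 K (by simpa using hK) S x (fun z => |cc z|) (fun z => abs_nonneg _)
  have habs : |∑ z ∈ S, K x z * cc z| ≤ ∑ z ∈ S, |K x z| * |cc z| :=
    (Finset.abs_sum_le_sum_abs _ _).trans (le_of_eq (Finset.sum_congr rfl fun z _ => abs_mul _ _))
  -- the tower level of `x`
  obtain ⟨J, hJn, hxJ⟩ := cover_dented c hL le_rfl x hxF
  rw [lamST_top] at hxJ
  have hdisj := towers_disjoint_dented c hL le_rfl
  rw [lamST_top] at hdisj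
  -- collapse of the level sum to `J`
  have hcollapse : ∀ j' ∈ Finset.range (c.k + 1),
      (if blockMap ((ℓ + 1) ^ j') x ∈ c.lamS j' then
        w j' * (((((ℓ + 1 : ℕ) : ℝ)) ^ (d + 1))⁻¹ ^ j') ^ 2 *
          ∑ z ∈ S.filter (fun z => blockMap ((ℓ + 1) ^ j') z = blockMap ((ℓ + 1) ^ j') x), |cc z| else 0)
      ≤ if j' = J then w J * (((((ℓ + 1 : ℕ) : ℝ)) ^ (d + 1))⁻¹ ^ J) ^ 2 *
          ∑ z ∈ S.filter (fun z => blockMap ((ℓ + 1) ^ J) z = blockMap ((ℓ + 1) ^ J) x), |cc z| else 0 := by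
    intro j' hj'
    have hj'n : j' ≤ c.k := Nat.lt_succ_iff.mp (Finset.mem_range.mp hj')
    by_cases h : blockMap ((ℓ + 1) ^ j') x ∈ c.lamS j'
    · have hjj : j' = J := (hdisj j' hj'n J hJn _ h _ hxJ x hxF rfl rfl).1
      subst hjj
      rw [if_pos h, if_pos rfl]
    · rw [if_neg h]
      split_ifs
      · exact mul_nonneg (mul_nonneg (hw0 J) (by positivity)) (Finset.sum_nonneg fun z _ => abs_nonneg _)
      · exact le_rfl
  have hlevel : ∑ j' ∈ Finset.range (c.k + 1),
      (if blockMap ((ℓ + 1) ^ j') x ∈ c.lamS j' then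
        w j' * (((((ℓ + 1 : ℕ) : ℝ)) ^ (d + 1))⁻¹ ^ j') ^ 2 *
          ∑ z ∈ S.filter (fun z => blockMap ((ℓ + 1) ^ j') z = blockMap ((ℓ + 1) ^ j') x), |cc z| else 0)
      ≤ w J * (((((ℓ + 1 : ℕ) : ℝ)) ^ (d + 1))⁻¹ ^ J) ^ 2 *
          ∑ z ∈ S.filter (fun z => blockMap ((ℓ + 1) ^ J) z = blockMap ((ℓ + 1) ^ J) x), |cc z| := by
    refine (Finset.sum_le_sum hcollapse).trans (le_of_eq ?_)
    rw [Finset.sum_ite_eq', if_pos (Finset.mem_range.mpr (Nat.lt_succ_of_le hJn))]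
  by_cases hJ2 : 2 ≤ J
  · -- DEEP SITE: everything vanishes
    have hx2 : x ∈ cube (ℓ + 1) c.a c.M c.ρ c.k 2 := cube_anti hJ2 hJn (mem_cube_of_tower c hxJ)
    have hk2 : 2 ≤ c.k := le_trans hJ2 hJn
    have hxd : (c.ρ : ℤ) * (ℓ + 1 : ℕ) ≤ depth hd (ℓ + 1) c.a c.M c.ρ c.k 1 x := by
      have := depth_ge_of_mem_inner hd c.a c.M c.ρ (show 1 < 2 by norm_num) hk2 hx2
      push_cast at this ⊢; rw [pow_one] at this; linarith
    have hnb : ∀ μ, cc (x + e μ) = 0 ∧ cc (x - e μ) = 0 := by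
      intro μ
      obtain ⟨h1, h2⟩ := abs_depth_sub_step_le hd (ℓ + 1) c.a c.M c.ρ c.k 1 x μ
      rw [abs_le] at h1 h2
      have hxd' : (c.ρ : ℤ) * (ℓ + 1 : ℕ) + 1 ≤ depth hd (ℓ + 1) c.a c.M c.ρ c.k 1 x := by
        have := depth_ge_of_mem_inner hd c.a c.M c.ρ (show 1 < 2 by norm_num) hk2 hx2
        push_cast at this ⊢; rw [pow_one] at this; linarith
      exact ⟨hdeep _ (by linarith) hxd, hdeep _ (by linarith) hxd⟩
    have hblk : ∑ z ∈ S.filter (fun z => blockMap ((ℓ + 1) ^ J) z = blockMap ((ℓ + 1) ^ J) x), |cc z| = 0 := by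
      refine Finset.sum_eq_zero fun z hz => ?_
      rw [Finset.mem_filter] at hz
      have hzJ : z ∈ cube (ℓ + 1) c.a c.M c.ρ c.k J := mem_cube_of_tower c (by rw [hz.2]; exact hxJ)
      have hz2 : z ∈ cube (ℓ + 1) c.a c.M c.ρ c.k 2 := cube_anti hJ2 hJn hzJ
      have hzd : (c.ρ : ℤ) * (ℓ + 1 : ℕ) ≤ depth hd (ℓ + 1) c.a c.M c.ρ c.k 1 z := by
        have := depth_ge_of_mem_inner hd c.a c.M c.ρ (show 1 < 2 by norm_num) hk2 hz2
        push_cast at this ⊢; rw [pow_one] at this; linarith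
      rw [hdeep z hzd hxd, abs_zero]
    have hzero : ∑ z ∈ S, |K x z| * |cc z| ≤ 0 := by
      refine hrow.trans ?_
      have h1 : ∑ μ : Fin (d + 1), (2 * |cc x| + |cc (x + e μ)| + |cc (x - e μ)|) = 0 :=
        Finset.sum_eq_zero fun μ _ => by rw [hcx, (hnb μ).1, (hnb μ).2, abs_zero]; ring
      rw [h1, mul_zero, zero_add]
      refine hlevel.trans ?_
      rw [hblk, mul_zero]
    have h0 : |∑ z ∈ S, K x z * cc z| = 0 := le_antisymm (habs.trans hzero) (abs_nonneg _)
    rw [h0, mul_zero]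
    positivity
  · -- SHALLOW SITE: tower level `J ≤ 1`, so `j ≤ 1`
    push Not at hJ2
    have hj1 : j ≤ 1 := by
      by_contra hj2; push Not at hj2
      rcases Nat.lt_or_ge J c.k with hJlt | hJge
      · exact not_mem_sq_of_tower_lt c hL le_rfl hJlt (lt_of_lt_of_le hJ2 hj2) hj (by rw [lamST_top]; exact hxJ) hxj
      · omega
    -- weight `≤ (Lη)²`
    have hwt : ((((ℓ + 1 : ℕ) : ℝ)) ^ j * η) ^ 2 ≤ ((((ℓ + 1 : ℕ) : ℝ)) * η) ^ 2 := by
      rw [mul_pow, mul_pow]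
      refine mul_le_mul_of_nonneg_right (pow_le_pow_left₀ (by positivity) ?_ 2) (sq_nonneg η)
      calc (((ℓ + 1 : ℕ) : ℝ)) ^ j ≤ (((ℓ + 1 : ℕ) : ℝ)) ^ 1 := pow_le_pow_right₀ hLr hj1
        _ = _ := pow_one _
    -- neighbour part
    have hl1 : ∀ μ, (l1dist (x + e μ) x : ℝ) ≤ 1 ∧ (l1dist (x - e μ) x : ℝ) ≤ 1 := by
      intro μ
      obtain ⟨h1, h2⟩ := abs_l1dist_step_le x x μ
      rw [l1dist_self, sub_zero, abs_le] at h1 h2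
      exact ⟨by exact_mod_cast h1.2, by exact_mod_cast h2.2⟩
    have hnbr : ∑ μ : Fin (d + 1), (2 * |cc x| + |cc (x + e μ)| + |cc (x - e μ)|) ≤ ((d : ℝ) + 1) * (2 * (A + B) / s) := by
      calc ∑ μ : Fin (d + 1), (2 * |cc x| + |cc (x + e μ)| + |cc (x - e μ)|)
          ≤ ∑ _μ : Fin (d + 1), (2 * (A + B) / s) := Finset.sum_le_sum fun μ _ => by
            rw [hcx, abs_zero, mul_zero, zero_add]
            have h1 := (hcle (x + e μ)).trans (mul_le_mul_of_nonneg_right (div_le_div_of_nonneg_right (hl1 μ).1 hs0.le) (by positivity))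
            have h2 := (hcle (x - e μ)).trans (mul_le_mul_of_nonneg_right (div_le_div_of_nonneg_right (hl1 μ).2 hs0.le) (by positivity))
            rw [one_div] at h1 h2
            have : 2 * (A + B) / (s : ℝ) = (s : ℝ)⁻¹ * (A + B) + (s : ℝ)⁻¹ * (A + B) := by field_simp; ring
            linarith
        _ = ((d : ℝ) + 1) * (2 * (A + B) / s) := by rw [Finset.sum_const, Finset.card_univ, Fintype.card_fin, nsmul_eq_mul]; push_cast; ring
    -- block part: `J = 0` gives nothing, `J = 1` gives at most `L^{d+1}` terms of size `(d+1)(L−1)(A+B)/s`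
    have hblock : w J * (((((ℓ + 1 : ℕ) : ℝ)) ^ (d + 1))⁻¹ ^ J) ^ 2 *
        ∑ z ∈ S.filter (fun z => blockMap ((ℓ + 1) ^ J) z = blockMap ((ℓ + 1) ^ J) x), |cc z| ≤ (η ^ 2)⁻¹ * (8 * ((d : ℝ) + 1) * (A + B) / s) := by
      rcases Nat.le_one_iff_eq_zero_or_eq_one.mp (Nat.lt_succ_iff.mp hJ2) with hJ0 | hJ1
      · -- `J = 0`: the block is `{x}` and `cc x = 0`
        subst hJ0
        have h0 : ∑ z ∈ S.filter (fun z => blockMap ((ℓ + 1) ^ 0) z = blockMap ((ℓ + 1) ^ 0) x), |cc z| = 0 := by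
          refine Finset.sum_eq_zero fun z hz => ?_
          rw [Finset.mem_filter, blockMap_pow_zero, blockMap_pow_zero] at hz
          rw [hz.2, hcx, abs_zero]
        rw [h0, mul_zero]; positivity
      · subst hJ1
        have hfullB : ∀ z, blockMap (ℓ + 1) z = blockMap (ℓ + 1) x → z ∈ S := by
          intro z hz
          exact (hS z).mpr (towerBlock_subset_sq_zero c hJn hxJ (by rw [pow_one]; exact hz))
        have hcard := card_filter_block_le ℓ S x hfullB
        have hterm : ∀ z ∈ S.filter (fun z => blockMap ((ℓ + 1) ^ 1) z = blockMap ((ℓ + 1) ^ 1) x),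
            |cc z| ≤ ((d : ℝ) + 1) * ℓ / s * (A + B) := by
          intro z hz
          rw [Finset.mem_filter, pow_one] at hz
          have hb := l1dist_le_of_blockMap_eq hL hz.2
          refine (hcle z).trans (mul_le_mul_of_nonneg_right (div_le_div_of_nonneg_right ?_ hs0.le) (by positivity))
          have : ((l1dist z x : ℤ) : ℝ) ≤ (((d + 1 : ℕ) : ℤ) * ((ℓ + 1 : ℕ) - 1) : ℤ) := by exact_mod_cast hb
          push_cast at this; linarith
        have hsum : ∑ z ∈ S.filter (fun z => blockMap ((ℓ + 1) ^ 1) z = blockMap ((ℓ + 1) ^ 1) x), |cc z|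
            ≤ ((ℓ + 1 : ℕ) : ℝ) ^ (d + 1) * (((d : ℝ) + 1) * ℓ / s * (A + B)) := by
          refine (Finset.sum_le_sum hterm).trans ?_
          rw [Finset.sum_const, nsmul_eq_mul]
          refine mul_le_mul_of_nonneg_right ?_ (by positivity)
          have hc' : (S.filter (fun z => blockMap ((ℓ + 1) ^ 1) z = blockMap ((ℓ + 1) ^ 1) x)).card ≤ (ℓ + 1) ^ (d + 1) := by
            simpa only [pow_one] using hcard
          exact_mod_cast hc'
        -- the coefficient `w₁L^{−2(d+1)} = η⁻²a₁L^{−2}L^{−(d+1)}`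
        have hw1 := hw 1 hk
        rw [pow_one] at hw1
        have hLpos : (0 : ℝ) < ((ℓ + 1 : ℕ) : ℝ) := by positivity
        calc w 1 * (((((ℓ + 1 : ℕ) : ℝ)) ^ (d + 1))⁻¹ ^ 1) ^ 2 *
              ∑ z ∈ S.filter (fun z => blockMap ((ℓ + 1) ^ 1) z = blockMap ((ℓ + 1) ^ 1) x), |cc z|
            ≤ ((η ^ 2)⁻¹ * levC d ℓ aw 1) * (((ℓ + 1 : ℕ) : ℝ) ^ (d + 1) * (((d : ℝ) + 1) * ℓ / s * (A + B))) := by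
              rw [pow_one, hw1]
              exact mul_le_mul_of_nonneg_left hsum (mul_nonneg (by positivity) (le_of_lt_or_eq (Or.inr rfl) |>.trans
                (by unfold levC; positivity)))
          _ = (η ^ 2)⁻¹ * (aw 1 * (((d : ℝ) + 1) * (A + B) / s) * ((ℓ : ℝ) / ((ℓ : ℝ) + 1) ^ 2)) := by
              unfold levC
              have : ((ℓ + 1 : ℕ) : ℝ) = (ℓ : ℝ) + 1 := by push_cast; ring
              rw [this]
              field_simp
          _ ≤ (η ^ 2)⁻¹ * (8 * (((d : ℝ) + 1) * (A + B) / s) * 1) := by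
              refine mul_le_mul_of_nonneg_left ?_ (by positivity)
              refine mul_le_mul (mul_le_mul_of_nonneg_right haw8 (by positivity)) ?_ (by positivity) (by positivity)
              rw [div_le_one (by positivity)]
              nlinarith [Nat.cast_nonneg (α := ℝ) ℓ]
          _ = (η ^ 2)⁻¹ * (8 * ((d : ℝ) + 1) * (A + B) / s) := by ring
    -- assemble
    have hη2 : 0 < η ^ 2 := by positivity
    have hrow' : ∑ z ∈ S, |K x z| * |cc z| ≤ (η ^ 2)⁻¹ * (10 * ((d : ℝ) + 1) * (A + B) / s) := by
      refine hrow.trans ?_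
      calc (η ^ 2)⁻¹ * ∑ μ : Fin (d + 1), (2 * |cc x| + |cc (x + e μ)| + |cc (x - e μ)|)
            + ∑ j' ∈ Finset.range (c.k + 1), (if blockMap ((ℓ + 1) ^ j') x ∈ c.lamS j' then
              w j' * (((((ℓ + 1 : ℕ) : ℝ)) ^ (d + 1))⁻¹ ^ j') ^ 2 *
                ∑ z ∈ S.filter (fun z => blockMap ((ℓ + 1) ^ j') z = blockMap ((ℓ + 1) ^ j') x), |cc z| else 0)
          ≤ (η ^ 2)⁻¹ * (((d : ℝ) + 1) * (2 * (A + B) / s)) + (η ^ 2)⁻¹ * (8 * ((d : ℝ) + 1) * (A + B) / s) :=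
            add_le_add (mul_le_mul_of_nonneg_left hnbr (by positivity)) (hlevel.trans hblock)
        _ = (η ^ 2)⁻¹ * (10 * ((d : ℝ) + 1) * (A + B) / s) := by ring
    calc ((((ℓ + 1 : ℕ) : ℝ)) ^ j * η) ^ 2 * |∑ z ∈ S, K x z * cc z|
        ≤ ((((ℓ + 1 : ℕ) : ℝ)) * η) ^ 2 * ((η ^ 2)⁻¹ * (10 * ((d : ℝ) + 1) * (A + B) / s)) :=
          mul_le_mul hwt (habs.trans hrow') (abs_nonneg _) (by positivity)
      _ = 10 * ((d : ℝ) + 1) * (((ℓ + 1 : ℕ) : ℝ)) ^ 2 * (A + B) / s := by field_simp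

/-! ## §5 The gradient of `P u` at deep bonds is the gradient of the region-A field -/

/-- **AT DEEP BONDS `P u` IS THE REGION-A FIELD**: if both ends of the bond `⟨y, y + e_μ⟩` have depth into `□₁` at least `4s`, then `h̃_A = 1`, `h̃_B = 0`
there and `(Pu)(y + e_μ) − (Pu)(y) = η²·(∂_μ G′uA)(y + t)` — p21's forward difference `dMat` of the host box.
[cite: Balaban1985RegularSpaces, (1.101) p.93 («… and the norm |·|₍₋₁₎ for their first derivatives»); Balaban1984PropagatorsII, (2.67) p.234] -/
theorem parametrix_grad_deep {ℓ Mh K' : ℕ} {Ω : ℕ → Set (Fin (d + 1) → ℤ)} (hℓ : 1 ≤ ℓ) (hMh2 : 2 ≤ Mh) (c : CubeB8D (d + 1) (ℓ + 1) K' Ω)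
    {η : ℝ} (aw : ℕ → ℝ) {s : ℕ} (hs : 1 ≤ s)
    (uA : ↥(boxDom (N0 ℓ Mh c.k (boxP ℓ c.M c.ρ c.k c.k))) → ℝ)
    (gAx : (Fin (d + 1) → ℤ) → ℝ)
    (hgAx : ∀ y : ↥(boxDom (N0 ℓ Mh c.k (boxP ℓ c.M c.ρ c.k c.k))),
      gAx (y.1 - shift ℓ Mh c.a c.ρ c.k c.k) = (gml (N0 ℓ Mh c.k (boxP ℓ c.M c.ρ c.k c.k)) ℓ c.k (levD Mh c) aw *ᵥ uA) y)
    (gBx : (Fin (d + 1) → ℤ) → ℝ)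
    {y : Fin (d + 1) → ℤ} (μ : Fin (d + 1)) (hy : 4 * (s : ℤ) ≤ depth (Nat.succ_pos d) (ℓ + 1) c.a c.M c.ρ c.k 1 y)
    (hy' : 4 * (s : ℤ) ≤ depth (Nat.succ_pos d) (ℓ + 1) c.a c.M c.ρ c.k 1 (y + e μ)) :
    ∃ (h₁ : y + shift ℓ Mh c.a c.ρ c.k c.k ∈ boxDom (N0 ℓ Mh c.k (boxP ℓ c.M c.ρ c.k c.k)))
      (_h₂ : y + shift ℓ Mh c.a c.ρ c.k c.k + Pi.single μ 1 ∈ boxDom (N0 ℓ Mh c.k (boxP ℓ c.M c.ρ c.k c.k))),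
      (cutAt (Nat.succ_pos d) (ℓ + 1) c.a c.M c.ρ c.k s (y + e μ) * (η ^ 2 * gAx (y + e μ)) + cutBt (Nat.succ_pos d) (ℓ + 1) c.a c.M c.ρ c.k s (y + e μ) * gBx (y + e μ))
        - (cutAt (Nat.succ_pos d) (ℓ + 1) c.a c.M c.ρ c.k s y * (η ^ 2 * gAx y) + cutBt (Nat.succ_pos d) (ℓ + 1) c.a c.M c.ρ c.k s y * gBx y)
      = η ^ 2 * (dMat (N0 ℓ Mh c.k (boxP ℓ c.M c.ρ c.k c.k)) μ *ᵥ (gml (N0 ℓ Mh c.k (boxP ℓ c.M c.ρ c.k c.k)) ℓ c.k (levD Mh c) aw *ᵥ uA))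
          ⟨y + shift ℓ Mh c.a c.ρ c.k c.k, h₁⟩ := by
  have hd : 0 < d + 1 := Nat.succ_pos d
  have hk : 1 ≤ c.k := c.one_le_k
  have hs1 : (1 : ℤ) ≤ s := by exact_mod_cast hs
  have hs4 : (1 : ℤ) ≤ 4 * s := by linarith
  have hy1 : y ∈ cube (ℓ + 1) c.a c.M c.ρ c.k 1 := (mem_cube_iff_one_le_depth hd c.a c.M c.ρ hk y).mpr (by linarith)
  have hy1' : y + e μ ∈ cube (ℓ + 1) c.a c.M c.ρ c.k 1 := (mem_cube_iff_one_le_depth hd c.a c.M c.ρ hk _).mpr (by linarith)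
  have h₁ := mem_boxDom_of_mem_cube_zero hℓ hMh2 c.a c.one_le_k le_rfl (cube_anti (Nat.zero_le 1) hk hy1)
  have h₂' := mem_boxDom_of_mem_cube_zero hℓ hMh2 c.a c.one_le_k le_rfl (cube_anti (Nat.zero_le 1) hk hy1')
  have heq : y + e μ + shift ℓ Mh c.a c.ρ c.k c.k = y + shift ℓ Mh c.a c.ρ c.k c.k + Pi.single μ 1 := ((add_shift_single (shift ℓ Mh c.a c.ρ c.k c.k) y μ).1).symm
  have h₂ : y + shift ℓ Mh c.a c.ρ c.k c.k + Pi.single μ 1 ∈ boxDom (N0 ℓ Mh c.k (boxP ℓ c.M c.ρ c.k c.k)) := by rw [← heq]; exact h₂'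
  refine ⟨h₁, h₂, ?_⟩
  -- plateau values of the cutoffs
  have hs2 : 2 * (s : ℤ) ≤ 4 * s := by linarith
  rw [(cutAt_eq_of_depth hd (ℓ + 1) c.a c.M c.ρ c.k hs y).1 (hs2.trans hy), (cutAt_eq_of_depth hd (ℓ + 1) c.a c.M c.ρ c.k hs (y + e μ)).1 (hs2.trans hy'),
    (cutBt_facts hd (ℓ + 1) c.a c.M c.ρ c.k hs y).2.2.1 hy, (cutBt_facts hd (ℓ + 1) c.a c.M c.ρ c.k hs (y + e μ)).2.2.1 hy']
  -- the forward difference of the host box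
  rw [dMat_mulVec_of_mem μ h₂]
  have e1 : gAx y = (gml (N0 ℓ Mh c.k (boxP ℓ c.M c.ρ c.k c.k)) ℓ c.k (levD Mh c) aw *ᵥ uA) ⟨y + shift ℓ Mh c.a c.ρ c.k c.k, h₁⟩ := by
    rw [← hgAx ⟨_, h₁⟩]; simp only [add_sub_cancel_right]
  have e2 : gAx (y + e μ) = (gml (N0 ℓ Mh c.k (boxP ℓ c.M c.ρ c.k c.k)) ℓ c.k (levD Mh c) aw *ᵥ uA) ⟨y + shift ℓ Mh c.a c.ρ c.k c.k + Pi.single μ 1, h₂⟩ := by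
    rw [← hgAx ⟨_, h₂⟩]; simp only [← heq, add_sub_cancel_right]
  rw [e1, e2]; ring

end Literature.MathematicalPhysics.QuantumFieldTheory.Balaban1983to89.B8Eq1101DentedCubeMemberCommutator
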